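import Mathlib
import Literature.NumberTheory.Transcendental.GammaIsoCross
import Literature.NumberTheory.Transcendental.GammaIsoCrossTransfer
import Literature.NumberTheory.Transcendental.GammaIsoCrossSaturation
import Literature.NumberTheory.Transcendental.ZilberField
import Literature.NumberTheory.Transcendental.ZilberFieldSaturationMain
import Literature.NumberTheory.Transcendental.ZilberGenericClosedness

/-!
# Stub `stub_realiseCopy` (line `eac-extends-core-automorphisms`, crux stmt-Schanuel-0968)

Realising the abstract copy in `ℂ` — step 5 of the doubling argument for the crux
`Summit.Schanuel.Schanuel.Theses.RigidCore.AclSubsetLogFreeCore` (Case I of the residue (A₀)).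

Setting: `τ ∈ ℂ` (in the application `τ = 2πi`), an exponential field `M` with kernel `τ₁ℤ`,
an isomorphism of base Γ-fields `σ₀ : ℚ(ℚτ₁, exp ℚτ₁) ≅ ℚ(ℚτ, exp ℚτ)`, and inside `M` two copies
`(c₁, e₁)`, `(c₁, e₂)` of a tuple `(c, e)` of `ℂ`, both cross-Γ-isomorphic to `(c, e)` over `σ₀`,
with `ℚτ₁ + ℚc₁ + ℚe₁ ◁ M`, `δ(e₂ / ℚτ₁ + ℚc₁ + ℚe₁) = 0` and `Σ qⱼ (e₂ⱼ − e₁ⱼ) ∉ ℚτ₁ + ℚc₁` for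
`q ≠ 0`; on the `ℂ` side `X = ℚτ + ℚc ◁ ℂ`, `X + ℚe ◁ ℂ`, `δ(e/X) = 0`, and `ℂ_exp` is a Zilber field.
Conclusion (`stub_realiseCopy`): there is `e'` in `ℂ` with `(c, e) ↦ (c, e')` a Γ-isomorphism over
the identity of `ℚ(ℚτ, exp ℚτ)`, `X + ℚe' ◁ ℂ`, and `Σ qⱼ (e'ⱼ − eⱼ) ∉ X` for `q ≠ 0`.

Proof (all ingredients are proved tree theorems):
* the cross-field `ℵ₀`-saturation over `ℚτ` (`ZilberSaturationLog.isGammaIsoTw₂_saturation_tau'`,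
  Bays–Kirby 2018 Lemma 8.3 across two fields) with `F₁ = M`, `F₂ = ℂ`, base point
  `(c₁, e₁) ↦ (c, e)` and extension `e₂` gives `E'` and a cross Γ-isomorphism
  `H : (c₁, e₁, e₂) ↦ (c, e, E')` over `σ₀`;
* restriction (`IsGammaIsoTw₂.comp`) gives `(c₁, e₂) ↦ (c, E')` over `σ₀`; composing with the
  inverse of the second copy `(c, e) ↦ (c₁, e₂)` over `σ₀⁻¹` (`.symm`, `.trans₂`) and
  `σ₀⁻¹ ∘ σ₀ = id` gives `(c, e) ↦ (c, E')` over the identity;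
* `δ(E'/X) = δ(e/X) = 0` because cross Γ-isomorphisms preserve `td` (`IsGammaIsoTw₂.td_sup_span_eq`)
  and `ldim` (transport of a basis modulo `X`, `IsGammaIsoTw₂.linIndepOver_transport`), so
  `X + ℚE' ◁ ℂ` by Bays–Kirby Lemma 4.8 (`IsStrong.of_predim_eq_zero`);
* general position is transported along `H⁻¹`: the transport map is additive, `ℚ`-linear, `σ₀⁻¹` on
  `ℚτ` (into `ℚτ₁`) and sends `c ↦ c₁`, `e ↦ e₁`, `E' ↦ e₂`, so `Σ qⱼ (E'ⱼ − eⱼ) ∈ X` would give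
  `Σ qⱼ (e₂ⱼ − e₁ⱼ) ∈ ℚτ₁ + ℚc₁`.

References: M. Bays, J. Kirby, *Pseudo-exponential maps, variants, and quasiminimality*, ANT 12
(2018), Def. 3.10, Lemma 4.8, Lemma 8.3.
-/

noncomputable section

-- `Summit.Schanuel.Schanuel.…` is the single-problem-summit namespace by design (D-0017).
set_option linter.dupNamespace false

open Set
open Literature.ModelTheory.ExponentialFields Literature.ModelTheory.ExponentialFields.ExponentialRing
open Literature.NumberTheory.Transcendental Literature.NumberTheory.Transcendental.GammaField

universe u

namespace Summit.Schanuel.Schanuel.Theorems.RigidCore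

/-! ### Bookkeeping for triple tuples `((c, e₁), e₂)` -/

section Tuples

variable {α : Type*} {N k : ℕ}

/-- Restricting `((c, e₁), e₂)` along the index map picking the `c`-block and the last block
gives `(c, e₂)`. -/
theorem append_append_comp_pick (c : Fin N → α) (e₁ e₂ : Fin k → α) :
    Fin.append (Fin.append c e₁) e₂ ∘
        Fin.append (fun i : Fin N => Fin.castAdd k (Fin.castAdd k i))
          (fun j : Fin k => Fin.natAdd (N + k) j) = Fin.append c e₂ := by
  funext s
  refine Fin.addCases (fun i => ?_) (fun j => ?_) s
  · simp
  · simp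

variable [AddCommGroup α] [Module ℚ α]

/-- `Σ qⱼ (e₂ⱼ − e₁ⱼ)` as a linear combination of the triple tuple `((c, e₁), e₂)`. -/
theorem sum_diff_eq_sum_append (c : Fin N → α) (e₁ e₂ : Fin k → α) (q : Fin k → ℚ) :
    ∑ s, Fin.append (Fin.append (0 : Fin N → ℚ) (-q)) q s • Fin.append (Fin.append c e₁) e₂ s =
      ∑ j, q j • (e₂ j - e₁ j) := by
  rw [Fin.sum_univ_add, Fin.sum_univ_add]
  simp only [Fin.append_left, Fin.append_right, Pi.zero_apply, zero_smul, Finset.sum_const_zero,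
    zero_add, Pi.neg_apply, neg_smul, Finset.sum_neg_distrib, smul_sub, Finset.sum_sub_distrib]
  abel

/-- `Σ pᵢ cᵢ` as a linear combination of the triple tuple `((c, e₁), e₂)`. -/
theorem sum_base_eq_sum_append (c : Fin N → α) (e₁ e₂ : Fin k → α) (p : Fin N → ℚ) :
    ∑ s, Fin.append (Fin.append p (0 : Fin k → ℚ)) (0 : Fin k → ℚ) s •
        Fin.append (Fin.append c e₁) e₂ s = ∑ i, p i • c i := by
  rw [Fin.sum_univ_add, Fin.sum_univ_add]
  simp only [Fin.append_left, Fin.append_right, Pi.zero_apply, zero_smul, Finset.sum_const_zero,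
    add_zero]

end Tuples

/-! ### Cross Γ-isomorphisms preserve `ldim` and `δ` over the extended bases -/

section Transfer

variable {F₁ : Type u} [Field F₁] [CharZero F₁] [ExponentialRing F₁]
variable {F₂ : Type u} [Field F₂] [CharZero F₂] [ExponentialRing F₂]
variable {K₁ : Submodule ℚ F₁} {K₂ : Submodule ℚ F₂} {σ : fieldOf K₁ ≃+* fieldOf K₂} {N k : ℕ}

/-- **`ldim(e/K₁ + ℚc) ≤ ldim(e'/K₂ + ℚc')`** for a cross Γ-isomorphism `(c, e) ↦ (c', e')` over an
isomorphism of base Γ-fields: a basis of `ℚe` modulo `K₁ + ℚc` chosen among the `eⱼ` is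
transported to a linearly independent family among the `e'ⱼ` modulo `K₂ + ℚc'`.
[cite: BaysKirby2018ANT, Def. 3.10, Def. 4.1] -/
theorem ldim_sup_span_le_of_isGammaIsoTw₂ {c : Fin N → F₁} {c' : Fin N → F₂} {e : Fin k → F₁}
    {e' : Fin k → F₂} (h : IsGammaIsoTw₂ σ (Fin.append c e) (Fin.append c' e'))
    (hσ : IsEBaseIso₂ K₁ K₂ σ) :
    ldim (K₁ ⊔ Submodule.span ℚ (range c)) (Submodule.span ℚ (range e)) ≤
      ldim (K₂ ⊔ Submodule.span ℚ (range c')) (Submodule.span ℚ (range e')) := by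
  classical
  obtain ⟨n, ρ, hu, hB⟩ :=
    ZilberSaturationMain.exists_linIndepOver_comp (K₁ ⊔ Submodule.span ℚ (range c)) e
  have hl : ldim (K₁ ⊔ Submodule.span ℚ (range c)) (Submodule.span ℚ (range e)) = n := by
    rw [← ldim_sup_left, ← hB, ldim_sup_left, ldim_span_eq_of_linIndepOver hu]
  have hcT : ∀ i, c i ∈ K₁ ⊔ Submodule.span ℚ (range (Fin.append c e)) := fun i =>
    Submodule.mem_sup_right (Submodule.subset_span ⟨Fin.castAdd k i, Fin.append_left c e i⟩)
  have huT : ∀ j, (e ∘ ρ) j ∈ K₁ ⊔ Submodule.span ℚ (range (Fin.append c e)) := fun j =>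
    Submodule.mem_sup_right (Submodule.subset_span ⟨Fin.natAdd N (ρ j), Fin.append_right c e (ρ j)⟩)
  have hind := h.linIndepOver_transport hσ hcT huT hu
  have hc' : (fun i => h.transport (c i)) = c' := by
    funext i
    have := h.transport_apply (Fin.castAdd k i)
    simpa only [Fin.append_left] using this
  have he' : (fun j => h.transport ((e ∘ ρ) j)) = e' ∘ ρ := by
    funext j
    have := h.transport_apply (Fin.natAdd N (ρ j))
    simpa only [Fin.append_right, Function.comp_apply] using this
  rw [hc', he'] at hind
  calc ldim (K₁ ⊔ Submodule.span ℚ (range c)) (Submodule.span ℚ (range e)) = n := hl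
    _ = ldim (K₂ ⊔ Submodule.span ℚ (range c')) (Submodule.span ℚ (range (e' ∘ ρ))) :=
      (ldim_span_eq_of_linIndepOver hind).symm
    _ ≤ ldim (K₂ ⊔ Submodule.span ℚ (range c')) (Submodule.span ℚ (range e')) :=
      ldim_mono (isFG_span_of_finite _ (finite_range e'))
        (Submodule.span_mono (range_comp_subset_range ρ e'))

/-- **Cross Γ-isomorphisms preserve `ldim` over the extended bases**:
`ldim(e/K₁ + ℚc) = ldim(e'/K₂ + ℚc')` for `(c, e) ↦ (c', e')` over an isomorphism of base
Γ-fields. [cite: BaysKirby2018ANT, Def. 3.10, Def. 4.1] -/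
theorem ldim_sup_span_eq_of_isGammaIsoTw₂ {c : Fin N → F₁} {c' : Fin N → F₂} {e : Fin k → F₁}
    {e' : Fin k → F₂} (h : IsGammaIsoTw₂ σ (Fin.append c e) (Fin.append c' e'))
    (hσ : IsEBaseIso₂ K₁ K₂ σ) :
    ldim (K₁ ⊔ Submodule.span ℚ (range c)) (Submodule.span ℚ (range e)) =
      ldim (K₂ ⊔ Submodule.span ℚ (range c')) (Submodule.span ℚ (range e')) :=
  le_antisymm (ldim_sup_span_le_of_isGammaIsoTw₂ h hσ)
    (ldim_sup_span_le_of_isGammaIsoTw₂ h.symm hσ.symm)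

/-- **Cross Γ-isomorphisms preserve the predimension over the extended bases** (no linear
independence needed): `δ(e'/K₂ + ℚc') = δ(e/K₁ + ℚc)` for `(c, e) ↦ (c', e')` over an
isomorphism of base Γ-fields. [cite: BaysKirby2018ANT, Def. 4.1] -/
theorem predim_sup_span_eq_of_isGammaIsoTw₂ {c : Fin N → F₁} {c' : Fin N → F₂} {e : Fin k → F₁}
    {e' : Fin k → F₂} (h : IsGammaIsoTw₂ σ (Fin.append c e) (Fin.append c' e'))
    (hσ : IsEBaseIso₂ K₁ K₂ σ) :
    predim (K₂ ⊔ Submodule.span ℚ (range c')) (Submodule.span ℚ (range e')) =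
      predim (K₁ ⊔ Submodule.span ℚ (range c)) (Submodule.span ℚ (range e)) := by
  rw [predim_def, predim_def, h.td_sup_span_eq hσ, ldim_sup_span_eq_of_isGammaIsoTw₂ h hσ]

/-- **Transport of general position along a cross Γ-isomorphism of triple tuples.** If
`((c, e₁), e₂) ↦ ((c', e₁'), e₂')` is a cross Γ-isomorphism over an isomorphism `σ` of base
Γ-fields `K₁ → K₂` and `Σ qⱼ (e₂ⱼ − e₁ⱼ) ∈ K₁ + ℚc`, then `Σ qⱼ (e₂'ⱼ − e₁'ⱼ) ∈ K₂ + ℚc'` (the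
transport map is additive, `ℚ`-linear, `σ` on `K₁` and maps the tuples coordinatewise).
[cite: BaysKirby2018ANT, Def. 3.10] -/
theorem sum_smul_sub_mem_of_isGammaIsoTw₂ {c : Fin N → F₁} {e₁ e₂ : Fin k → F₁} {c' : Fin N → F₂}
    {e₁' e₂' : Fin k → F₂}
    (H : IsGammaIsoTw₂ σ (Fin.append (Fin.append c e₁) e₂) (Fin.append (Fin.append c' e₁') e₂'))
    (hσ : IsEBaseIso₂ K₁ K₂ σ) (q : Fin k → ℚ)
    (hq : (∑ j, q j • (e₂ j - e₁ j)) ∈ K₁ ⊔ Submodule.span ℚ (range c)) :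
    (∑ j, q j • (e₂' j - e₁' j)) ∈ K₂ ⊔ Submodule.span ℚ (range c') := by
  classical
  obtain ⟨κ, hκ, y, hy, hsum⟩ := Submodule.mem_sup.1 hq
  obtain ⟨p, rfl⟩ := (Submodule.mem_span_range_iff_exists_fun ℚ).1 hy
  have key : H.transport (∑ s, Fin.append (Fin.append (0 : Fin N → ℚ) (-q)) q s •
      Fin.append (Fin.append c e₁) e₂ s) =
      H.transport (κ + ∑ s, Fin.append (Fin.append p (0 : Fin k → ℚ)) (0 : Fin k → ℚ) s •
        Fin.append (Fin.append c e₁) e₂ s) := by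
    rw [sum_diff_eq_sum_append, sum_base_eq_sum_append, hsum]
  rw [H.transport_sum_smul, H.transport_add_sum_smul hκ, sum_diff_eq_sum_append,
    sum_base_eq_sum_append] at key
  rw [key]
  exact add_mem (Submodule.mem_sup_left (hσ.map_mem hκ)) (Submodule.mem_sup_right
    (Submodule.sum_mem _ fun i _ => Submodule.smul_mem _ _ (Submodule.subset_span ⟨i, rfl⟩)))

end Transfer

/-! ### The realisation -/

/-- **Realising the abstract copy in `ℂ`, over an abstract kernel generator name `τ`.** The
statement of `stub_realiseCopy` for any `τ : ℂ` (the hypothesis `τ = 2πi` is not needed: the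
cross-field saturation theorem only uses the kernel of the SOURCE field `M`).
[cite: BaysKirby2018ANT, Lemma 8.3, Lemma 4.8, Def. 3.10] -/
theorem realiseCopy_of_isZilberField (hZ : IsZilberField ℂ) (τ : ℂ)
    (M : Type) [Field M] [CharZero M] [ExponentialRing M] (τ₁ : M)
    (hker : expKernel M = AddSubgroup.zmultiples τ₁) (hτ₁ : τ₁ ≠ 0)
    (σ₀ : fieldOf (Submodule.span ℚ ({τ₁} : Set M)) ≃+*
      fieldOf (Submodule.span ℚ ({τ} : Set ℂ)))
    (hσ₀ : IsEBaseIso₂ (Submodule.span ℚ ({τ₁} : Set M))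
      (Submodule.span ℚ ({τ} : Set ℂ)) σ₀)
    {N k : ℕ} (c₁ : Fin N → M) (e₁ e₂ : Fin k → M) (c : Fin N → ℂ) (e : Fin k → ℂ)
    (h₁ : IsGammaIsoTw₂ σ₀ (Fin.append c₁ e₁) (Fin.append c e))
    (h₂ : IsGammaIsoTw₂ σ₀ (Fin.append c₁ e₂) (Fin.append c e))
    (hsM : IsStrong (Submodule.span ℚ ({τ₁} : Set M) ⊔ Submodule.span ℚ (range (Fin.append c₁ e₁))))
    (hδM : predim (Submodule.span ℚ ({τ₁} : Set M) ⊔ Submodule.span ℚ (range (Fin.append c₁ e₁)))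
      (Submodule.span ℚ (range e₂)) = 0)
    (hnew : ∀ q : Fin k → ℚ, q ≠ 0 →
      (∑ j, q j • (e₂ j - e₁ j)) ∉ Submodule.span ℚ ({τ₁} : Set M) ⊔ Submodule.span ℚ (range c₁))
    (hX : IsStrong (Submodule.span ℚ ({τ} : Set ℂ) ⊔ Submodule.span ℚ (range c)))
    (hXe : IsStrong (Submodule.span ℚ ({τ} : Set ℂ) ⊔
      Submodule.span ℚ (range (Fin.append c e))))
    (hδe : predim (Submodule.span ℚ ({τ} : Set ℂ) ⊔ Submodule.span ℚ (range c))
      (Submodule.span ℚ (range e)) = 0) :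
    ∃ e' : Fin k → ℂ,
      IsGammaIsoTw₂ (RingEquiv.refl (fieldOf (Submodule.span ℚ ({τ} : Set ℂ))))
        (Fin.append c e) (Fin.append c e') ∧
      IsStrong (Submodule.span ℚ ({τ} : Set ℂ) ⊔
        Submodule.span ℚ (range (Fin.append c e'))) ∧
      ∀ q : Fin k → ℚ, q ≠ 0 →
        (∑ j, q j • (e' j - e j)) ∉
          Submodule.span ℚ ({τ} : Set ℂ) ⊔ Submodule.span ℚ (range c) := by
  classical
  -- Step 1: cross-field saturation, `F₁ = M`, `F₂ = ℂ`, base point `(c₁, e₁) ↦ (c, e)`, extension `e₂`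
  obtain ⟨E', H, -, -⟩ := ZilberSaturationLog.isGammaIsoTw₂_saturation_tau' (F₁ := M) (F₂ := ℂ)
    hZ.isSurjectiveOntoUnits hZ.isStronglyExpAlgClosed hker hτ₁ hσ₀ (e := e₂) hsM hXe h₁ hδM
  -- Step 2: the sub-tuple `(c₁, e₂) ↦ (c, E')`
  have G₁ : IsGammaIsoTw₂ σ₀ (Fin.append c₁ e₂) (Fin.append c E') := by
    have := H.comp (Fin.append (fun i : Fin N => Fin.castAdd k (Fin.castAdd k i))
      (fun j : Fin k => Fin.natAdd (N + k) j))
    rwa [append_append_comp_pick, append_append_comp_pick] at this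
  -- Step 3: `(c, e) ↦ (c₁, e₂) ↦ (c, E')` over `σ₀⁻¹ ∘ σ₀ = id`
  have ι : IsGammaIsoTw₂ (RingEquiv.refl (fieldOf (Submodule.span ℚ ({τ} : Set ℂ))))
      (Fin.append c e) (Fin.append c E') := by
    have := h₂.symm.trans₂ G₁
    rwa [RingEquiv.symm_trans_self] at this
  refine ⟨E', ι, ?_, ?_⟩
  · -- Step 4: `δ(E'/X) = δ(e/X) = 0`, so `X + ℚE' ◁ ℂ` (Bays–Kirby Lemma 4.8)
    have hpred : predim (Submodule.span ℚ ({τ} : Set ℂ) ⊔ Submodule.span ℚ (range c))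
        (Submodule.span ℚ (range E')) = 0 := by
      rw [predim_sup_span_eq_of_isGammaIsoTw₂ ι (IsEBaseIso₂.refl _)]
      exact hδe
    have hs : IsStrong ((Submodule.span ℚ ({τ} : Set ℂ) ⊔ Submodule.span ℚ (range c)) ⊔
        Submodule.span ℚ (range E')) :=
      hX.of_predim_eq_zero le_sup_left (isFG_sup_left.2 (isFG_span_of_finite _ (finite_range E')))
        (by rw [predim_sup_left]; exact hpred)
    rwa [ZilberHomogeneity.range_append, Submodule.span_union, ← sup_assoc]
  · -- Step 5: general position, transported along `H⁻¹ : (c, e, E') ↦ (c₁, e₁, e₂)`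
    intro q hq hmem
    exact hnew q hq (sum_smul_sub_mem_of_isGammaIsoTw₂ H.symm hσ₀.symm q hmem)

/-- **Stub `stub_realiseCopy` — realising the abstract copy in `ℂ`** (cross-field saturation +
composition). In the situation produced by `stub_doubleModel` — an exponential field `M` with
kernel `τ₁ℤ`, an isomorphism of base Γ-fields `σ₀ : ℚ(ℚτ₁, exp) ≅ ℚ(ℚ·2πi, exp)`, two copies
`(c₁, e₁)`, `(c₁, e₂)` in `M` of the `ℂ`-tuple `(c, e)`, both cross-Γ-isomorphic to `(c, e)` over
`σ₀`, with `ℚτ₁ + ℚc₁ + ℚe₁ ◁ M`, `δ(e₂/ℚτ₁ + ℚc₁ + ℚe₁) = 0` and `Σ qⱼ(e₂ⱼ − e₁ⱼ) ∉ ℚτ₁ + ℚc₁`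
(`q ≠ 0`) — if `ℂ_exp` is a Zilber field then the second copy is realised in `ℂ` over `(c, e)`:
there is `e'` with `(c, e) ↦ (c, e')` a Γ-isomorphism over the identity of `ℚ^{ab}(2πi)`,
`ℚ·2πi + ℚc + ℚe' ◁ ℂ`, and `Σ qⱼ(e'ⱼ − eⱼ) ∉ ℚ·2πi + ℚc` for `q ≠ 0`. Proof:
`ZilberSaturationLog.isGammaIsoTw₂_saturation_tau'` (Bays–Kirby 2018 Lemma 8.3 across two
fields) with `F₁ = M`, `F₂ = ℂ`; restriction and composition of cross Γ-isomorphisms;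
`δ`-invariance and Lemma 4.8; transport of the general-position clause.
[cite: BaysKirby2018ANT, Lemma 8.3, Lemma 4.8, Def. 3.10] -/
theorem stub_realiseCopy (hZ : IsZilberField ℂ) (τ : ℂ) (hτ : τ = 2 * ↑Real.pi * Complex.I)
    (M : Type) [Field M] [CharZero M] [ExponentialRing M] (τ₁ : M)
    (hker : expKernel M = AddSubgroup.zmultiples τ₁) (hτ₁ : τ₁ ≠ 0)
    (σ₀ : fieldOf (Submodule.span ℚ ({τ₁} : Set M)) ≃+*
      fieldOf (Submodule.span ℚ ({τ} : Set ℂ)))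
    (hσ₀ : IsEBaseIso₂ (Submodule.span ℚ ({τ₁} : Set M))
      (Submodule.span ℚ ({τ} : Set ℂ)) σ₀)
    {N k : ℕ} (c₁ : Fin N → M) (e₁ e₂ : Fin k → M) (c : Fin N → ℂ) (e : Fin k → ℂ)
    (h₁ : IsGammaIsoTw₂ σ₀ (Fin.append c₁ e₁) (Fin.append c e))
    (h₂ : IsGammaIsoTw₂ σ₀ (Fin.append c₁ e₂) (Fin.append c e))
    (hsM : IsStrong (Submodule.span ℚ ({τ₁} : Set M) ⊔ Submodule.span ℚ (range (Fin.append c₁ e₁))))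
    (hδM : predim (Submodule.span ℚ ({τ₁} : Set M) ⊔ Submodule.span ℚ (range (Fin.append c₁ e₁)))
      (Submodule.span ℚ (range e₂)) = 0)
    (hnew : ∀ q : Fin k → ℚ, q ≠ 0 →
      (∑ j, q j • (e₂ j - e₁ j)) ∉ Submodule.span ℚ ({τ₁} : Set M) ⊔ Submodule.span ℚ (range c₁))
    (hX : IsStrong (Submodule.span ℚ ({τ} : Set ℂ) ⊔ Submodule.span ℚ (range c)))
    (hXe : IsStrong (Submodule.span ℚ ({τ} : Set ℂ) ⊔
      Submodule.span ℚ (range (Fin.append c e))))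
    (hδe : predim (Submodule.span ℚ ({τ} : Set ℂ) ⊔ Submodule.span ℚ (range c))
      (Submodule.span ℚ (range e)) = 0) :
    ∃ e' : Fin k → ℂ,
      IsGammaIsoTw₂ (RingEquiv.refl (fieldOf (Submodule.span ℚ ({τ} : Set ℂ))))
        (Fin.append c e) (Fin.append c e') ∧
      IsStrong (Submodule.span ℚ ({τ} : Set ℂ) ⊔
        Submodule.span ℚ (range (Fin.append c e'))) ∧
      ∀ q : Fin k → ℚ, q ≠ 0 →
        (∑ j, q j • (e' j - e j)) ∉
          Submodule.span ℚ ({τ} : Set ℂ) ⊔ Submodule.span ℚ (range c) := by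
  subst hτ
  exact realiseCopy_of_isZilberField hZ _ M τ₁ hker hτ₁ σ₀ hσ₀ c₁ e₁ e₂ c e h₁ h₂ hsM hδM hnew
    hX hXe hδe

end Summit.Schanuel.Schanuel.Theorems.RigidCore
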